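import Literature.Probability.RandomPlanarGeometry.BoundaryCorrespondence
import Literature.Probability.RandomPlanarGeometry.ChordalBoundary
import Literature.Probability.RandomPlanarGeometry.ConformalMapCaratheodoryProofs
import Literature.Probability.RandomPlanarGeometry.CaratheodoryHalfPlaneProofs
import Literature.Probability.RandomPlanarGeometry.LoewnerDescriptionProofs

/-!
# The two real half-lines and the two boundary arcs of a chordal uniformiser
# (route `SAWWeldingIdentification`, helper for item `WeldingSetup`, stmt-CriticalPhenomena-4504)

Let `φ : (ℍ; 0, ∞) → (D; a, b)` be a chordal uniformising map of a Dobrushin domain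
(`MarkedDomain.IsChordalUniformizing`). Carathéodory's theorem (tree:
`JordanDomain.exists_continuousOn_extension_holds`) makes the boundary correspondence
`x ↦ φ.boundaryExtension x` a continuous injection of `ℝ` onto `∂D ∖ {b}` with `0 ↦ a`. Hence the
two open half-lines `(0, ∞)` and `(-∞, 0)` are carried onto the two "components" of
`∂D ∖ {a, b}`. We prove this in the form needed by the welding set-up: whenever
`∂D ∖ {a, b} = A ∪ B` with `A, B` non-empty and separated (`closure A ∩ B = ∅ = A ∩ closure B`),
the image of `(0, ∞)` is one of `A, B` and the image of `(-∞, 0)` is the other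
(`image_Ioi_and_image_Iio_of_isChordalUniformizing`); which one is decided by a single point
(`image_Ioi_eq_of_mem`, `image_Iio_eq_of_mem`). Applied three times by the route: to the
four-marked domain `Ω` (arcs through `c_L` and through `c_R`) and to the two banks of a chord
(boundary arc versus open chord).

References: Ch. Pommerenke, *Boundary Behaviour of Conformal Maps* (1992), Thm. 2.6.
-/

noncomputable section

namespace Summit.CriticalPhenomena.SAWScalingLimit.Theorems

open Set Filter Topology Complex Metric
open UpperHalfPlane (upperHalfPlaneSet)
open Literature.Probability.RandomPlanarGeometry

/-- A preconnected subset of `A ∪ B`, where `A` misses `closure B` and `B` misses `closure A`,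
lies in `A` or in `B`. [folklore] -/
theorem subset_or_subset_of_isPreconnected_of_separated {A B S : Set ℂ}
    (hA : Disjoint (closure A) B) (hB : Disjoint A (closure B)) (hS : IsPreconnected S)
    (hsub : S ⊆ A ∪ B) : S ⊆ A ∨ S ⊆ B := by
  have hcover : S ⊆ (closure B)ᶜ ∪ (closure A)ᶜ := by
    intro x hx
    rcases hsub hx with hxA | hxB
    · exact Or.inl fun hxB' => Set.disjoint_left.1 hB hxA hxB'
    · exact Or.inr fun hxA' => Set.disjoint_left.1 hA hxA' hxB
  have hempty : S ∩ ((closure B)ᶜ ∩ (closure A)ᶜ) = ∅ := by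
    ext x
    simp only [mem_inter_iff, mem_compl_iff, mem_empty_iff_false, iff_false, not_and, not_not]
    intro hx hxB
    rcases hsub hx with hxA | hxB'
    · exact subset_closure hxA
    · exact absurd (subset_closure hxB') hxB
  have h := (isPreconnected_iff_subset_of_disjoint.1 hS) (closure B)ᶜ (closure A)ᶜ
    isClosed_closure.isOpen_compl isClosed_closure.isOpen_compl hcover hempty
  rcases h with h | h
  · left
    intro x hx
    rcases hsub hx with hxA | hxB
    · exact hxA
    · exact absurd (subset_closure hxB) (h hx)
  · right
    intro x hx
    rcases hsub hx with hxA | hxB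
    · exact absurd (subset_closure hxA) (h hx)
    · exact hxB

variable {D : DobrushinDomain} (φ : ConformalEquiv upperHalfPlaneSet D.carrier)

/-- The boundary extension of a chordal uniformiser at `0` is the first marked point `a`.
[folklore] -/
theorem boundaryExtension_zero_of_isChordalUniformizing (hφ : D.IsChordalUniformizing φ) :
    φ.boundaryExtension ((0 : ℝ) : ℂ) = D.pt 0 :=
  JordanDomain.boundaryExtension_eq_of_hasBoundaryValue' φ (by simp) (by simpa using hφ.1)

/-- **Every boundary point except `a`, `b` is the image of a nonzero real point** under the
boundary extension of a chordal uniformiser `φ : (ℍ; 0, ∞) → (D; a, b)` (Carathéodory's boundary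
correspondence, `JordanDomain.existsUnique_real_or_infty_holds`). [folklore] -/
theorem exists_ne_zero_boundaryExtension_eq (hφ : D.IsChordalUniformizing φ) {p : ℂ}
    (hp : p ∈ frontier D.carrier) (hpa : p ≠ D.pt 0) (hpb : p ≠ D.pt 1) :
    ∃ t : ℝ, t ≠ 0 ∧ φ.boundaryExtension t = p := by
  rcases JordanDomain.existsUnique_real_or_infty_holds D.toJordanDomain φ hp with
    ⟨x, hx, -⟩ | hinf
  · refine ⟨x, ?_, JordanDomain.boundaryExtension_eq_of_hasBoundaryValue' φ (by simp) hx⟩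
    rintro rfl
    apply hpa
    rw [← JordanDomain.boundaryExtension_eq_of_hasBoundaryValue' φ (by simp) hx]
    exact boundaryExtension_zero_of_isChordalUniformizing φ hφ
  · haveI := neBot_cocompact_inf_principal_upperHalfPlaneSet
    exact absurd (tendsto_nhds_unique hinf hφ.2) hpb

/-- The image of the nonzero reals under the boundary extension of a chordal uniformiser of
`(D; a, b)` is exactly `∂D ∖ {a, b}`. [folklore] -/
theorem image_ne_zero_boundaryExtension_eq (hφ : D.IsChordalUniformizing φ) :
    (fun t : ℝ => φ.boundaryExtension t) '' {t : ℝ | t ≠ 0} =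
      frontier D.carrier \ {D.pt 0, D.pt 1} := by
  obtain ⟨Φ, hΦ⟩ := JordanDomain.exists_isDiscExtension
    JordanDomain.exists_continuousOn_extension_holds φ (D := D.toJordanDomain)
  apply Subset.antisymm
  · rintro _ ⟨t, ht, rfl⟩
    refine ⟨hΦ.boundaryExtension_ofReal_mem_frontier t, ?_⟩
    rintro (h | h)
    · exact MarkedDomain.boundaryExtension_ofReal_ne_pt_zero
        JordanDomain.exists_continuousOn_extension_holds hφ ht h
    · exact MarkedDomain.boundaryExtension_ofReal_ne_pt_one
        JordanDomain.exists_continuousOn_extension_holds hφ t h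
  · rintro p ⟨hp, hpab⟩
    simp only [mem_insert_iff, mem_singleton_iff, not_or] at hpab
    obtain ⟨t, ht, htp⟩ := exists_ne_zero_boundaryExtension_eq φ hφ hp hpab.1 hpab.2
    exact ⟨t, ht, htp⟩

/-- **The two half-lines go to the two arcs.** Let `φ : (ℍ; 0, ∞) → (D; a, b)` be a chordal
uniformiser and let `∂D ∖ {a, b} = A ∪ B` with `A`, `B` non-empty and separated
(`closure A ∩ B = ∅`, `A ∩ closure B = ∅`). Then the boundary correspondence maps `(0, ∞)` onto
one of `A`, `B` and `(-∞, 0)` onto the other: the two images are connected subsets of `A ∪ B`,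
hence each lies in `A` or in `B`, and together they cover `A ∪ B`. (Carathéodory's boundary
correspondence, Pommerenke 1992 Thm. 2.6.) [folklore] -/
theorem image_Ioi_and_image_Iio_of_isChordalUniformizing (hφ : D.IsChordalUniformizing φ)
    {A B : Set ℂ} (hAB : A ∪ B = frontier D.carrier \ {D.pt 0, D.pt 1})
    (hA : Disjoint (closure A) B) (hB : Disjoint A (closure B))
    (hAne : A.Nonempty) (hBne : B.Nonempty) :
    ((fun t : ℝ => φ.boundaryExtension t) '' Ioi 0 = A ∧
        (fun t : ℝ => φ.boundaryExtension t) '' Iio 0 = B) ∨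
      ((fun t : ℝ => φ.boundaryExtension t) '' Ioi 0 = B ∧
        (fun t : ℝ => φ.boundaryExtension t) '' Iio 0 = A) := by
  set Ψ : ℝ → ℂ := fun t : ℝ => φ.boundaryExtension t with hΨ
  have hdisj : Disjoint A B := hB.mono_right subset_closure
  -- continuity of the boundary correspondence on the real line
  have hcont : Continuous Ψ := by
    have h := JordanDomain.continuousOn_boundaryExtension_holds D.toJordanDomain φ
    exact h.comp_continuous continuous_ofReal fun x =>
      mem_closure_upperHalfPlaneSet_iff.2 (by simp)
  -- images of the half-lines are connected subsets of `A ∪ B`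
  have himage : Ψ '' {t : ℝ | t ≠ 0} = A ∪ B := by
    rw [hAB]; exact image_ne_zero_boundaryExtension_eq φ hφ
  have hPsub : Ψ '' Ioi 0 ⊆ A ∪ B := by
    rw [← himage]; exact image_mono fun t ht => ne_of_gt ht
  have hNsub : Ψ '' Iio 0 ⊆ A ∪ B := by
    rw [← himage]; exact image_mono fun t ht => ne_of_lt ht
  have hPconn : IsPreconnected (Ψ '' Ioi 0) := isPreconnected_Ioi.image Ψ hcont.continuousOn
  have hNconn : IsPreconnected (Ψ '' Iio 0) := isPreconnected_Iio.image Ψ hcont.continuousOn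
  have hP := subset_or_subset_of_isPreconnected_of_separated hA hB hPconn hPsub
  have hN := subset_or_subset_of_isPreconnected_of_separated hA hB hNconn hNsub
  -- together they cover `A ∪ B`
  have hcov : A ∪ B ⊆ Ψ '' Ioi 0 ∪ Ψ '' Iio 0 := by
    rw [← himage]
    rintro _ ⟨t, ht, rfl⟩
    rcases lt_or_gt_of_ne (show t ≠ 0 from ht) with hlt | hgt
    · exact Or.inr ⟨t, hlt, rfl⟩
    · exact Or.inl ⟨t, hgt, rfl⟩
  obtain ⟨qA, hqA⟩ := hAne
  obtain ⟨qB, hqB⟩ := hBne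
  rcases hP with hP | hP <;> rcases hN with hN | hN
  · -- both in `A`: then `B` is empty
    exfalso
    rcases hcov (Or.inr hqB) with h | h
    · exact Set.disjoint_left.1 hdisj (hP h) hqB
    · exact Set.disjoint_left.1 hdisj (hN h) hqB
  · left
    refine ⟨hP.antisymm fun x hx => ?_, hN.antisymm fun x hx => ?_⟩
    · rcases hcov (Or.inl hx) with h | h
      · exact h
      · exact absurd (hN h) (Set.disjoint_left.1 hdisj hx)
    · rcases hcov (Or.inr hx) with h | h
      · exact absurd hx (Set.disjoint_left.1 hdisj (hP h))
      · exact h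
  · right
    refine ⟨hP.antisymm fun x hx => ?_, hN.antisymm fun x hx => ?_⟩
    · rcases hcov (Or.inr hx) with h | h
      · exact h
      · exact absurd hx (Set.disjoint_left.1 hdisj (hN h))
    · rcases hcov (Or.inl hx) with h | h
      · exact absurd (hP h) (Set.disjoint_left.1 hdisj hx)
      · exact h
  · -- both in `B`: then `A` is empty
    exfalso
    rcases hcov (Or.inl hqA) with h | h
    · exact Set.disjoint_left.1 hdisj hqA (hP h)
    · exact Set.disjoint_left.1 hdisj hqA (hN h)

/-- If some positive real point is sent into `A`, the positive half-line is sent onto `A` and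
the negative one onto `B` (hypotheses as in
`image_Ioi_and_image_Iio_of_isChordalUniformizing`). [folklore] -/
theorem image_Ioi_eq_of_mem (hφ : D.IsChordalUniformizing φ)
    {A B : Set ℂ} (hAB : A ∪ B = frontier D.carrier \ {D.pt 0, D.pt 1})
    (hA : Disjoint (closure A) B) (hB : Disjoint A (closure B))
    (hAne : A.Nonempty) (hBne : B.Nonempty) {t₀ : ℝ} (ht₀ : 0 < t₀)
    (hmem : φ.boundaryExtension t₀ ∈ A) :
    (fun t : ℝ => φ.boundaryExtension t) '' Ioi 0 = A ∧
      (fun t : ℝ => φ.boundaryExtension t) '' Iio 0 = B := by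
  rcases image_Ioi_and_image_Iio_of_isChordalUniformizing φ hφ hAB hA hB hAne hBne with h | h
  · exact h
  · exfalso
    have hdisj : Disjoint A B := hB.mono_right subset_closure
    have : φ.boundaryExtension t₀ ∈ B := h.1 ▸ ⟨t₀, ht₀, rfl⟩
    exact Set.disjoint_left.1 hdisj hmem this

/-- If some negative real point is sent into `A`, the negative half-line is sent onto `A` and
the positive one onto `B`. [folklore] -/
theorem image_Iio_eq_of_mem (hφ : D.IsChordalUniformizing φ)
    {A B : Set ℂ} (hAB : A ∪ B = frontier D.carrier \ {D.pt 0, D.pt 1})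
    (hA : Disjoint (closure A) B) (hB : Disjoint A (closure B))
    (hAne : A.Nonempty) (hBne : B.Nonempty) {t₀ : ℝ} (ht₀ : t₀ < 0)
    (hmem : φ.boundaryExtension t₀ ∈ A) :
    (fun t : ℝ => φ.boundaryExtension t) '' Iio 0 = A ∧
      (fun t : ℝ => φ.boundaryExtension t) '' Ioi 0 = B := by
  rcases image_Ioi_and_image_Iio_of_isChordalUniformizing φ hφ hAB hA hB hAne hBne with h | h
  · exfalso
    have hdisj : Disjoint A B := hB.mono_right subset_closure
    have : φ.boundaryExtension t₀ ∈ B := h.2 ▸ ⟨t₀, ht₀, rfl⟩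
    exact Set.disjoint_left.1 hdisj hmem this
  · exact ⟨h.2, h.1⟩

end Summit.CriticalPhenomena.SAWScalingLimit.Theorems
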